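import Summits.BirchSwinnertonDyer.BirchSwinnertonDyer.Theorems.EisensteinPrimesGoodLatticeResidualPairDeterminant
import Summits.BirchSwinnertonDyer.BirchSwinnertonDyer.Theorems.EisensteinPrimesGoodLatticeAnacongEulerCompMultiplicative
import Literature.NumberTheory.EllipticCurves.OpenImageMazurFrobeniusProofs
import Literature.NumberTheory.EllipticCurves.LFunctionPrimeCoeff
import HarnessLib

/-!
# Kriz's Eisenstein-descent condition (1) at the GOOD primes `ℓ ≠ p` for the quotient Teichmüller character:
# `a_ℓ(E) ≡ φ̃(ℓ) + φ̃(ℓ)⁻¹·ℓ (mod 𝔭)` — Mazur 1978 Prop. 6.3 (1) read through the rational `p`-line's quotient character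
# (cell `bsd-eis`, width seat `bsd-line-x1-p1-w2` gen 26; helper for crux 2 `GoodLatticeBDPValue`, `--supports stmt-BirchSwinnertonDyer-19032`)

WHY. The named fact `proofThm221_congruence_of_fullEisensteinDescent` (CGLS 2022's proof of Thm. 2.2.1 from (eq:cong-mf),
typed by this seat; consumer `GoodLatticeAnacongOfCGLSProofThm221.anacong_of_proofThm221_of_thmI`) takes as hypotheses Kriz 2016
Def. 31 (1)–(5) for the type `(φ̃, φ̃⁻¹, N₊, N₋, N₀)`, `φ̃ = θquot` the Teichmüller lift of the character of `Γ_ℚ` on `E[p]/Φ`.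
Condition (1) — `a_ℓ ≡ ψ₁(ℓ) + ψ₂(ℓ)ℓ^{k−1}` for `ℓ ∤ N`, i.e. `a_ℓ(E) ≡ φ̃(ℓ) + φ̃(ℓ)⁻¹ℓ (mod 𝔭)` — is, at a good prime `ℓ ≠ p`,
the trace of Frobenius on `E[p]` read on the stable line: Mazur's Prop. 6.3 (1) `r(φ_ℓ) + ℓ·r(φ_ℓ)⁻¹ ≡ a_ℓ` for the isogeny
character `r` of `Φ` (tree: `Mazur1978.isogenyCharacter_add_div_eq_frobeniusTrace`), together with `det ρ̄ = χ̄_p` on the line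
(`EisensteinPrimesMuLambda.det_eq_mul_of_smul_eq_of_smul_sub_mem`: `r(σ)·θquot(σ) ≡ χ̄_p(σ)`, `= ℓ` at `φ_ℓ`). This file proves it
in the exact shape of that hypothesis (the Frobenius value `a` of `θquot` at the place `u ∋ ℓ`, `a_ℓ = WeierstrassCurve.LFunction W ℓ`).
The case `ℓ = p` (where `a_p ≡ θquot(Frob_p)`, the unit root) and the existence of the type from the full-descent datum are NOT here.

* `kriz_one_of_hasGoodReductionAtPrime` — the displayed congruence.

HONEST FRAMING: helper theorem (0 definitions, 0 named facts, 0 sorry); closes no stub; no summit statement / crux / BSD /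
theorem of CGLS or Kriz is proved here. References: [Mazur1978] §5 (p. 148), Prop. 6.3 (1) (p. 153); [Kriz2016] Def. 31 (1),
Thm. 34 (1)(3), Thm. 35; [SilvermanCSS1997] Ch. II §7 (det ρ̄ = χ); [DiamondShurman2005] §8.8 (8.44) (a_p the L-series coefficient).
-/

set_option autoImplicit false
set_option linter.dupNamespace false

noncomputable section

open scoped Classical

open WeierstrassCurve NumberField IsDedekindDomain Field
  Literature.NumberTheory.EllipticCurves Literature.NumberTheory.EllipticCurves.Rank1Residual
  Literature.NumberTheory.GaloisRepresentations
  Literature.NumberTheory.EllipticCurves.GreenbergSelmer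
  Literature.NumberTheory.EllipticCurves.KellerYin2024

namespace Summit.BirchSwinnertonDyer.BirchSwinnertonDyer.Theorems.GoodLatticeKrizTraceCondition

variable {p : ℕ} [hp : Fact p.Prime] {S : Set (PadicAlgCl p)}

/-- **Kriz Def. 31 (1) at a good prime `ℓ ≠ p`: `a_ℓ(E) ≡ φ̃(ℓ) + φ̃(ℓ)⁻¹·ℓ (mod 𝔭)`.** For `W/ℚ` globally minimal elliptic, a
prime `p`, a rational `p`-line `Φ ≤ E[p]` with a Teichmüller lift `θquot : Γ_ℚ → GL₁(𝒪)` of the character on `E[p]/Φ`, a prime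
`ℓ ≠ p` of good reduction, a place `u ∋ ℓ` of `ℚ` and `a ∈ 𝒪` with `θquot(Frob_u) = a` (`HasFrobCharpolyAt u (X − a)`):
`‖a_ℓ(W) − (a + a⁻¹ℓ)‖ < 1`, `a_ℓ(W) = WeierstrassCurve.LFunction W ℓ`. Proof: Mazur 1978 Prop. 6.3 (1) for the isogeny character
`r` of `Φ` (`r(φ) + ℓ r(φ)⁻¹ = ā_ℓ`), `r(φ)·θquot(φ) ≡ χ̄_p(φ) = ℓ` (determinant on the line), so `θquot(φ) ≡ ℓ r(φ)⁻¹` and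
`θquot(φ) + θquot(φ)⁻¹ℓ ≡ ℓ r(φ)⁻¹ + r(φ) ≡ a_ℓ`; lifted from `𝔽_p` to `𝒪 ⊂ ℚ̄_p`.
[cite: Mazur1978, §5 (p. 148) and Prop. 6.3 (1) (p. 153)] [cite: Kriz2016, Def. 31 (1), Thm. 34 (1)(3)]
[cite: SilvermanCSS1997, Ch. II §7 Proposition (det ρ̄_m = χ_m)] -/
theorem kriz_one_of_hasGoodReductionAtPrime (W : WeierstrassCurve ℚ) [W.IsElliptic] [W.IsGloballyMinimal]
    {Φ : AddSubgroup (geomTorsion W (p : ℤ))} (hΦ : IsRationalLine W p Φ)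
    {θquot : FramedGaloisRep ℚ (padicCoeffIntegers S) 1}
    (hquot : IsTeichmullerLiftOnQuot S (Φ.map (geomTorsion W (p : ℤ)).subtype) (geomTorsion W (p : ℤ)) θquot)
    {ℓ : ℕ} [hℓ : Fact ℓ.Prime] (hℓp : ℓ ≠ p) (hgoodℓ : W.HasGoodReductionAtPrime ℓ)
    {u : HeightOneSpectrum (𝓞 ℚ)} (hu : ((ℓ : ℕ) : 𝓞 ℚ) ∈ u.asIdeal)
    {a : padicCoeffIntegers S} (ha : θquot.HasFrobCharpolyAt u (Polynomial.X - Polynomial.C a)) :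
    ‖((W.LFunction ℓ : ℤ) : PadicAlgCl p) - ((a : PadicAlgCl p) + (a : PadicAlgCl p)⁻¹ * (ℓ : PadicAlgCl p))‖ < 1 := by
  have hpp := hp.out
  haveI : NeZero ((p : ℕ) : ℚ) := ⟨by exact_mod_cast hpp.ne_zero⟩
  -- the line is cyclic on a generator `P`, with isogeny character `r`
  obtain ⟨P, hP0, hΦP⟩ := Mazur1978.exists_eq_zmultiples_of_natCard_eq W p hΦ.1
  have hst : ∀ σ : absoluteGaloisGroup ℚ, σ • P ∈ AddSubgroup.zmultiples P := fun σ ↦ by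
    rw [← hΦP]; exact hΦ.2 σ P (hΦP ▸ AddSubgroup.mem_zmultiples P)
  obtain ⟨r, hr⟩ := Mazur1978.exists_isogenyCharacter W p hP0 hst
  -- a Frobenius at `u`
  obtain ⟨𝔓, h𝔓⟩ := HeightOneSpectrum.primesAbove_nonempty u
  obtain ⟨φ, hφ⟩ := HeightOneSpectrum.exists_isArithFrobAt_of_mem_primesAbove_holds h𝔓
  -- Mazur Prop. 6.3 (1): `r(φ) + ℓ r(φ)⁻¹ = a_ℓ` in `𝔽_p`; `a_ℓ` is the `ℓ`-th Dirichlet coefficient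
  have hmaz := Mazur1978.isogenyCharacter_add_div_eq_frobeniusTrace W p ℓ hℓp hgoodℓ hP0 hr hu h𝔓 hφ
  have haℓ : W.LFunction ℓ = W.frobeniusTrace ℓ := LFunction_apply_prime_eq_frobeniusTrace W ℓ hgoodℓ
  have hχ := Mazur1978.modPCyclotomicCharacterZMod_of_isArithFrobAt p ℓ hℓp hu h𝔓 hφ
  -- `θquot(φ) = a`, and its integer scalar `d` on `E[p]/Φ`
  have hentry : KellerYin2024.entry S θquot φ = a := by
    have h := ha 𝔓 h𝔓 φ hφ
    rw [GoodLatticeAnacongEulerCompMultiplicative.charpoly_eq_X_sub_C_entry] at h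
    rwa [sub_right_inj, Polynomial.C_inj] at h
  obtain ⟨d, hd, hdΦ⟩ := hquot.2 φ
  rw [hentry] at hd
  -- a torsion point outside the line, and the determinant on the line: `r(φ)·d = χ̄_p(φ) = ℓ`
  have hcardΦ : Nat.card (Φ.map (geomTorsion W (p : ℤ)).subtype) = p := by
    rw [Nat.card_congr (Φ.equivMapOfInjective (geomTorsion W (p : ℤ)).subtype
      (geomTorsion W (p : ℤ)).subtype_injective).toEquiv.symm, hΦ.1]
  obtain ⟨S₀', hS₀'T, hS₀'Φ⟩ := EisensteinPrimesMuLambda.exists_mem_geomTorsion_not_mem W (N := p) hcardΦ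
  set S₀ : geomTorsion W (p : ℤ) := ⟨S₀', hS₀'T⟩ with hS₀def
  have hS₀Φ : S₀ ∉ AddSubgroup.zmultiples P := by
    intro hmem
    rw [← hΦP] at hmem
    exact hS₀'Φ (AddSubgroup.mem_map.mpr ⟨S₀, hmem, rfl⟩)
  have hdS₀ : φ • S₀ - d • S₀ ∈ AddSubgroup.zmultiples P := by
    obtain ⟨T, hT, hTeq⟩ := AddSubgroup.mem_map.mp (hdΦ S₀' hS₀'T)
    have hT' : T = φ • S₀ - d • S₀ := by
      apply Subtype.ext
      rw [AddSubgroupClass.coe_sub, AddSubgroup.torsionBy.coe_smul, AddSubgroupClass.coe_zsmul]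
      exact hTeq
    rw [← hT', ← hΦP]
    exact hT
  have hra : φ • P = ((((r φ : (ZMod p)ˣ) : ZMod p).val : ℕ) : ℤ) • P := by
    rw [natCast_zsmul]; exact hr φ
  have hdet := EisensteinPrimesMuLambda.det_eq_mul_of_smul_eq_of_smul_sub_mem W p hP0 φ hra hS₀Φ hdS₀
  rw [hχ] at hdet
  -- arithmetic in `𝔽_p`: `x := r(φ)`, `x·d = ℓ`, `x + ℓ x⁻¹ = ā_ℓ` ⟹ `ā_ℓ = d + d⁻¹ ℓ`
  have hℓ0 : (ℓ : ZMod p) ≠ 0 := by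
    rw [Ne, ZMod.natCast_eq_zero_iff]
    exact fun h' ↦ hℓp ((Nat.prime_dvd_prime_iff_eq hpp hℓ.out).mp h').symm
  set x : ZMod p := ((r φ : (ZMod p)ˣ) : ZMod p) with hx
  have hxval : (((x.val : ℕ) : ℤ) : ZMod p) = x := by rw [Int.cast_natCast, ZMod.natCast_zmod_val]
  have hxd : x * (d : ZMod p) = (ℓ : ZMod p) := by
    have h := hdet
    push_cast at h
    rw [ZMod.natCast_zmod_val] at h
    exact h
  have hx0 : x ≠ 0 := (r φ).ne_zero
  have hd0 : (d : ZMod p) ≠ 0 := by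
    intro h0; rw [h0, mul_zero] at hxd; exact hℓ0 hxd.symm
  have hinv : (((r φ)⁻¹ : (ZMod p)ˣ) : ZMod p) = x⁻¹ := by rw [hx, Units.val_inv_eq_inv_val]
  have htrace : ((W.LFunction ℓ : ℤ) : ZMod p) = (d : ZMod p) + (d : ZMod p)⁻¹ * (ℓ : ZMod p) := by
    rw [haℓ, ← hmaz, hinv]
    have hdx : (d : ZMod p) = (ℓ : ZMod p) * x⁻¹ := by
      field_simp
      rw [mul_comm]; exact hxd
    rw [hdx, mul_inv, inv_inv]
    field_simp
    ring
  -- lift to `𝒪 ⊂ ℚ̄_p`: `a ≡ d`, `a⁻¹ ≡ c` with `c ≡ d⁻¹ (mod p)`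
  set c : ℤ := (((d : ZMod p)⁻¹).val : ℤ) with hc
  have hcval : (c : ZMod p) = (d : ZMod p)⁻¹ := by rw [hc, Int.cast_natCast, ZMod.natCast_zmod_val]
  have hm : ((W.LFunction ℓ : ℤ) : ZMod p) = ((d + c * ℓ : ℤ) : ZMod p) := by
    rw [htrace]; push_cast; rw [hcval]
  -- `‖a_ℓ − (d + cℓ)‖ < 1`
  have h1 : ‖((W.LFunction ℓ : ℤ) : PadicAlgCl p) - ((d + c * ℓ : ℤ) : PadicAlgCl p)‖ < 1 := by
    rw [show ((W.LFunction ℓ : ℤ) : PadicAlgCl p) - ((d + c * ℓ : ℤ) : PadicAlgCl p) =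
        (((W.LFunction ℓ - (d + c * ℓ) : ℤ) : ℚ_[p]) : PadicAlgCl p) by push_cast; rfl,
      PadicAlgCl.norm_extends, Padic.norm_intCast_lt_one_iff, ← ZMod.intCast_eq_intCast_iff_dvd_sub]
    exact hm.symm
  -- norms of `a`, `d`, `c`
  have hdnorm : ‖(d : PadicAlgCl p)‖ = 1 := by
    rw [show (d : PadicAlgCl p) = (((d : ℤ) : ℚ_[p]) : PadicAlgCl p) by rfl, PadicAlgCl.norm_extends]
    refine le_antisymm (Padic.norm_int_le_one d) (not_lt.mp fun hlt ↦ hd0 ?_)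
    rw [Padic.norm_intCast_lt_one_iff] at hlt
    rw [ZMod.intCast_zmod_eq_zero_iff_dvd]; exact hlt
  have hanorm : ‖(a : PadicAlgCl p)‖ = 1 := by
    have e : (a : PadicAlgCl p) = (d : PadicAlgCl p) + ((a : PadicAlgCl p) - (d : PadicAlgCl p)) := by ring
    rw [e, IsUltrametricDist.norm_add_eq_max_of_norm_ne_norm (by rw [hdnorm]; exact hd.ne'), hdnorm,
      max_eq_left hd.le]
  have ha0 : (a : PadicAlgCl p) ≠ 0 := fun h0 ↦ by rw [h0, norm_zero] at hanorm; exact zero_ne_one hanorm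
  have hcle : ‖(c : PadicAlgCl p)‖ ≤ 1 := by
    rw [show (c : PadicAlgCl p) = (((c : ℤ) : ℚ_[p]) : PadicAlgCl p) by rfl, PadicAlgCl.norm_extends]
    exact Padic.norm_int_le_one c
  -- `‖1 − a c‖ < 1`: `a c − 1 = (a − d) c + (d c − 1)`, `p ∣ d c − 1`
  have hdc : ‖(d : PadicAlgCl p) * (c : PadicAlgCl p) - 1‖ < 1 := by
    rw [show (d : PadicAlgCl p) * (c : PadicAlgCl p) - 1 = (((d * c - 1 : ℤ) : ℚ_[p]) : PadicAlgCl p) by push_cast; rfl,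
      PadicAlgCl.norm_extends, Padic.norm_intCast_lt_one_iff, ← ZMod.intCast_zmod_eq_zero_iff_dvd]
    push_cast
    rw [hcval, mul_inv_cancel₀ hd0, sub_self]
  have hac : ‖(a : PadicAlgCl p) * (c : PadicAlgCl p) - 1‖ < 1 := by
    have e : (a : PadicAlgCl p) * (c : PadicAlgCl p) - 1 =
        ((a : PadicAlgCl p) - (d : PadicAlgCl p)) * (c : PadicAlgCl p) + ((d : PadicAlgCl p) * (c : PadicAlgCl p) - 1) := by
      ring
    rw [e]
    refine (IsUltrametricDist.norm_add_le_max _ _).trans_lt (max_lt ?_ hdc)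
    rw [norm_mul]
    calc ‖(a : PadicAlgCl p) - (d : PadicAlgCl p)‖ * ‖(c : PadicAlgCl p)‖
        ≤ ‖(a : PadicAlgCl p) - (d : PadicAlgCl p)‖ * 1 := mul_le_mul_of_nonneg_left hcle (norm_nonneg _)
      _ < 1 := by rw [mul_one]; exact hd
  -- `‖a⁻¹ ℓ − c ℓ‖ < 1`
  have h2 : ‖(a : PadicAlgCl p)⁻¹ * (ℓ : PadicAlgCl p) - (c : PadicAlgCl p) * (ℓ : PadicAlgCl p)‖ < 1 := by
    have e : (a : PadicAlgCl p)⁻¹ * (ℓ : PadicAlgCl p) - (c : PadicAlgCl p) * (ℓ : PadicAlgCl p) =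
        -((a : PadicAlgCl p)⁻¹ * (ℓ : PadicAlgCl p) * ((a : PadicAlgCl p) * (c : PadicAlgCl p) - 1)) := by
      field_simp
      ring
    have hℓle : ‖(ℓ : PadicAlgCl p)‖ ≤ 1 := by
      rw [show (ℓ : PadicAlgCl p) = (((ℓ : ℤ) : ℚ_[p]) : PadicAlgCl p) by push_cast; rfl, PadicAlgCl.norm_extends]
      exact Padic.norm_int_le_one _
    rw [e, norm_neg, norm_mul, norm_mul, norm_inv, hanorm, inv_one, one_mul]
    calc ‖(ℓ : PadicAlgCl p)‖ * ‖(a : PadicAlgCl p) * (c : PadicAlgCl p) - 1‖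
        ≤ 1 * ‖(a : PadicAlgCl p) * (c : PadicAlgCl p) - 1‖ := mul_le_mul_of_nonneg_right hℓle (norm_nonneg _)
      _ < 1 := by rw [one_mul]; exact hac
  -- assemble
  have h3 : ‖((a : PadicAlgCl p) + (a : PadicAlgCl p)⁻¹ * (ℓ : PadicAlgCl p)) - ((d + c * ℓ : ℤ) : PadicAlgCl p)‖ < 1 := by
    have e : ((a : PadicAlgCl p) + (a : PadicAlgCl p)⁻¹ * (ℓ : PadicAlgCl p)) - ((d + c * ℓ : ℤ) : PadicAlgCl p) =
        ((a : PadicAlgCl p) - (d : PadicAlgCl p)) +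
          ((a : PadicAlgCl p)⁻¹ * (ℓ : PadicAlgCl p) - (c : PadicAlgCl p) * (ℓ : PadicAlgCl p)) := by
      push_cast; ring
    rw [e]
    exact (IsUltrametricDist.norm_add_le_max _ _).trans_lt (max_lt hd h2)
  have e : ((W.LFunction ℓ : ℤ) : PadicAlgCl p) - ((a : PadicAlgCl p) + (a : PadicAlgCl p)⁻¹ * (ℓ : PadicAlgCl p)) =
      (((W.LFunction ℓ : ℤ) : PadicAlgCl p) - ((d + c * ℓ : ℤ) : PadicAlgCl p)) -
        (((a : PadicAlgCl p) + (a : PadicAlgCl p)⁻¹ * (ℓ : PadicAlgCl p)) - ((d + c * ℓ : ℤ) : PadicAlgCl p)) := by ring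
  rw [e, sub_eq_add_neg]
  refine (IsUltrametricDist.norm_add_le_max _ _).trans_lt (max_lt h1 ?_)
  rw [norm_neg]; exact h3

end Summit.BirchSwinnertonDyer.BirchSwinnertonDyer.Theorems.GoodLatticeKrizTraceCondition

end
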